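import Literature.Geometry.Kaehler.HodgeStarProofs
import Literature.Geometry.Kaehler.HodgeStarFrame
import Literature.LinearAlgebra.Alternating.WedgeOne

/-!
# `⋆(ξ ∧ ⋆γ) = ± ι_{ξ♯} γ`: the Hodge star conjugates wedge with a covector into contraction

On an oriented `n`-dimensional real inner product space `V`, for a covector `ξ : V →L[ℝ] ℝ` with
Riesz dual `ξ♯ = (toDual ℝ V).symm ξ`, a `(k+1)`-form `γ` and the Hodge stars
`⋆ : Λ^{k+1} → Λ^m` (`(k+1) + m = n`) and `⋆ : Λ^{m+1} → Λ^k` (`(m+1) + k = n`):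

* `hodgeStar_wedgeOne_hodgeStar`: `⋆ (ξ ∧ ⋆γ) = (-1)^{km} • (ξ♯ ⌟ γ)`,

where `ξ ∧ ·` is `Literature.LinearAlgebra.Alternating.wedgeOne` (the alternatization convention of
Mathlib's `extDeriv`) and `ξ♯ ⌟ γ = γ.curryLeft ξ♯`. Equivalently `⋆⁻¹ (ξ ∧ ·) ⋆ = ± ι_{ξ♯}`: the
interior product is the `⋆`-conjugate (and the adjoint) of the exterior product — the pointwise
identity that turns the codifferential `d* = ±⋆d⋆` into `-∑ ι_{e_i} ∇_{e_i}` and, on a Hermitian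
vector space, the symbol of `∂̄* = -⋆∂⋆` into a contraction (Voisin (2002), §5.1.2 and proof of
Lemma 6.6, `∂̄* = -∑ 2 ∂/∂z_i ∘ int(∂/∂z̄_i)` on flat space; Warner (1983), Ex. 2.13–2.14 and
6.2). In even dimension `n` the sign is `+1` in every degree.

Proof: both sides are linear in `ξ`, so take `ξ = ⟪e₀, ·⟫` for a unit vector `e₀`, extend `e₀` to
an orthonormal basis `b` with `b 0 = e₀` and compare values on the increasing basis tuples `b_J`
(`HodgeStarAux.ext_multiIndex`). If `0 ∈ J` both sides vanish. If `0 ∉ J`, in the frame sum for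
the outer star only the complement `T = Jᶜ ∋ 0` survives, `(ξ ∧ ⋆γ)(b_T) = (⋆γ)(b_{T∖0})`, in the
frame sum for `⋆γ` only `S = J ∪ {0}` survives, `γ(b_S) = γ(e₀, b_J) = (ι_{e₀} γ)(b_J)`, and the two
volume factors `vol(0, J, T∖0) · vol(0, T∖0, J)` multiply to the sign `(-1)^{km}` of the block
rotation (`HodgeStarAux.append_cast_swap`, `sign_finRotate_pow`).

## References

* C. Voisin, *Hodge Theory and Complex Algebraic Geometry I* (2002), §5.1.2; §6.1.1, proof of
  Lemma 6.6 (p. 140). [Voisin2002]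
* F. W. Warner, *Foundations of Differentiable Manifolds and Lie Groups*, GTM 94 (1983), Ch. 2,
  Ex. 13–14; 6.1–6.2. [WarnerGTM94]
-/

noncomputable section

open Module ContinuousAlternatingMap Function Set.powersetCard
open Literature.LinearAlgebra.Alternating

namespace Literature.Geometry.Kaehler

namespace HodgeStarAux

/-! ### Increasing enumerations with the distinguished minimum `0` -/

section Enum

variable {n k : ℕ}

/-- If `0 ∈ s` then the increasing enumeration of `s ⊆ Fin (n+1)` starts at `0`. [folklore] -/
theorem enum_zero_of_zero_mem {s : Set.powersetCard (Fin (n + 1)) (k + 1)}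
    (h0 : (0 : Fin (n + 1)) ∈ s) : ofFinEmbEquiv.symm s 0 = 0 := by
  rw [ofFinEmbEquiv_symm_apply, show (0 : Fin (k + 1)) = ⟨0, Nat.succ_pos k⟩ from rfl,
    Finset.orderEmbOfFin_zero]
  exact le_antisymm (Finset.min'_le _ _ (mem_coe_iff.2 h0)) (Fin.zero_le _)

/-- If `0 ∈ s` then the other values of the increasing enumeration of `s` are nonzero. [folklore] -/
theorem enum_succ_ne_zero {s : Set.powersetCard (Fin (n + 1)) (k + 1)}
    (h0 : (0 : Fin (n + 1)) ∈ s) (i : Fin k) : ofFinEmbEquiv.symm s i.succ ≠ 0 := by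
  rw [← enum_zero_of_zero_mem h0]
  exact fun h ↦ Fin.succ_ne_zero i ((ofFinEmbEquiv.symm s).injective h)

/-- If `0 ∉ t` then all values of the increasing enumeration of `t` are positive. [folklore] -/
theorem enum_pos_of_zero_notMem {t : Set.powersetCard (Fin (n + 1)) k}
    (h0 : (0 : Fin (n + 1)) ∉ t) (i : Fin k) : 0 < ofFinEmbEquiv.symm t i :=
  Fin.pos_iff_ne_zero.2 fun h ↦ h0 (h ▸ enum_mem t i)

/-- The set `s ∖ {0}` for `0 ∈ s`, as an element of `powersetCard _ k`. [folklore] -/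
theorem card_erase_zero {s : Set.powersetCard (Fin (n + 1)) (k + 1)} (h0 : (0 : Fin (n + 1)) ∈ s) :
    ((s : Finset (Fin (n + 1))).erase 0) ∈ Set.powersetCard (Fin (n + 1)) k := by
  rw [mem_iff, Finset.card_erase_of_mem (mem_coe_iff.2 h0), card_eq]
  rfl

/-- **Tail of the enumeration**: for `0 ∈ s`, the increasing enumeration of `s ∖ {0}` is the tail
`i ↦ e_s (i+1)` of that of `s`. [folklore] -/
theorem enum_erase_zero {s : Set.powersetCard (Fin (n + 1)) (k + 1)} (h0 : (0 : Fin (n + 1)) ∈ s) :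
    ⇑(ofFinEmbEquiv.symm (⟨_, card_erase_zero h0⟩ : Set.powersetCard (Fin (n + 1)) k)) =
      ofFinEmbEquiv.symm s ∘ Fin.succ := by
  rw [ofFinEmbEquiv_symm_apply]
  refine (Finset.orderEmbOfFin_unique _ (fun i ↦ ?_) ?_).symm
  · exact Finset.mem_erase.2 ⟨enum_succ_ne_zero h0 i, mem_coe_iff.2 (enum_mem s i.succ)⟩
  · exact (ofFinEmbEquiv.symm s).strictMono.comp Fin.strictMono_succ

/-- The set `t ∪ {0}` for `0 ∉ t`, as an element of `powersetCard _ (k+1)`. [folklore] -/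
theorem card_insert_zero {t : Set.powersetCard (Fin (n + 1)) k} (h0 : (0 : Fin (n + 1)) ∉ t) :
    insert (0 : Fin (n + 1)) (t : Finset (Fin (n + 1))) ∈ Set.powersetCard (Fin (n + 1)) (k + 1) := by
  rw [mem_iff, Finset.card_insert_of_notMem (fun h ↦ h0 (mem_coe_iff.1 h)), card_eq]

/-- **Cons of the enumeration**: for `0 ∉ t`, the increasing enumeration of `t ∪ {0}` is `0`
followed by that of `t`. [folklore] -/
theorem enum_insert_zero {t : Set.powersetCard (Fin (n + 1)) k} (h0 : (0 : Fin (n + 1)) ∉ t) :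
    ⇑(ofFinEmbEquiv.symm (⟨_, card_insert_zero h0⟩ : Set.powersetCard (Fin (n + 1)) (k + 1))) =
      Fin.cons (0 : Fin (n + 1)) (ofFinEmbEquiv.symm t) := by
  rw [ofFinEmbEquiv_symm_apply]
  refine (Finset.orderEmbOfFin_unique _ (fun i ↦ ?_) ?_).symm
  · refine Fin.cases ?_ (fun j ↦ ?_) i
    · simp
    · simpa using Or.inr (mem_coe_iff.2 (enum_mem t j))
  · cases k with
    | zero =>
      intro i j hij
      exfalso
      have hi := i.2
      have hj := j.2
      rw [Fin.lt_def] at hij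
      omega
    | succ k =>
      exact (strictMono_vecCons (f := ⇑(ofFinEmbEquiv.symm t))).2
        ⟨enum_pos_of_zero_notMem h0 0, (ofFinEmbEquiv.symm t).strictMono⟩

end Enum

/-! ### The Hodge star on increasing tuples of an arbitrary orthonormal basis -/

section Star

variable {V : Type*} [NormedAddCommGroup V] [InnerProductSpace ℝ V] [FiniteDimensional ℝ V]
  {n : ℕ} [Fact (finrank ℝ V = n)] (o : Orientation ℝ V (Fin n)) {k m : ℕ}

/-- The Hodge star on an increasing tuple `b ∘ e t` of **any** orthonormal basis `b`:
`(⋆β)(b ∘ e t) = ∑ₛ β(b ∘ e s) · vol(b ∘ [e s | e t])` (`hodgeStar_apply_multiIndex` for the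
standard basis, transported by `hodgeStar_eq_hodgeStarFrame`). [folklore] -/
theorem hodgeStar_apply_multiIndex_of_orthonormalBasis (b : OrthonormalBasis (Fin n) ℝ V)
    (h : k + m = n) (β : V [⋀^Fin k]→L[ℝ] ℝ) (t : Set.powersetCard (Fin n) m) :
    hodgeStar o h β (b.multiIndex t) =
      ∑ s : Set.powersetCard (Fin n) k, β (b.multiIndex s) *
        o.volumeForm (b ∘ (Fin.append (ofFinEmbEquiv.symm s) (ofFinEmbEquiv.symm t) ∘
          Fin.cast h.symm)) := by
  rw [hodgeStar_eq_hodgeStarFrame o b, hodgeStarFrame_apply]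
  refine Finset.sum_congr rfl fun s _ ↦ ?_
  rw [interiorProductMulti_apply, domDomCongr_apply, Orientation.volumeFormL_apply]
  congr 2
  funext i
  simp only [comp_apply, finCongr_apply, Fin.cast_cast]
  generalize Fin.cast _ i = x
  cases x using Fin.addCases <;> simp [OrthonormalBasis.multiIndex, frameMultiIndex]

end Star

/-! ### Blocks behind a leading `0`, and the sign of their swap -/

section ConsBlock

variable {X : Type*} {k m N : ℕ}

/-- `[0 :: f | g] = 0 :: [f | g]` (casts along `(k+1)+m = N+1`, `k+m = N`). [folklore] -/
theorem append_cons_comp_cast (a : X) (f : Fin k → X) (g : Fin m → X) (h : (k + 1) + m = N + 1)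
    (hkm : k + m = N) :
    Fin.append (Fin.cons a f) g ∘ Fin.cast h.symm =
      Fin.cons a (Fin.append f g ∘ Fin.cast hkm.symm) := by
  subst hkm
  rw [Fin.append_cons]
  funext i
  simp only [comp_apply, Fin.cast_cast]
  refine Fin.cases ?_ (fun j ↦ ?_) i
  · simp
  · have : Fin.cast (h.symm.trans (Nat.add_right_comm k 1 m)) j.succ = (Fin.cast rfl j).succ :=
      Fin.ext rfl
    rw [this, Fin.cons_succ, Fin.cons_succ]
    rfl

variable {V : Type*} [NormedAddCommGroup V] [InnerProductSpace ℝ V]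
  [Fact (finrank ℝ V = N + 1)] (o : Orientation ℝ V (Fin (N + 1)))
  (b : OrthonormalBasis (Fin (N + 1)) ℝ V)

/-- **Swapping the two blocks behind a fixed leading vector** multiplies the volume form by the
sign `(-1)^{km}` of the block rotation: `vol(b₀, b_g, b_f) = (-1)^{km} vol(b₀, b_f, b_g)`.
[folklore] -/
theorem volumeForm_cons_block_swap (hkm : k + m = N) (hmk : m + k = N) (f : Fin k → Fin (N + 1))
    (g : Fin m → Fin (N + 1)) :
    o.volumeForm (b ∘ Fin.cons 0 (Fin.append g f ∘ Fin.cast hmk.symm)) =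
      (-1) ^ (k * m) * o.volumeForm (b ∘ Fin.cons 0 (Fin.append f g ∘ Fin.cast hkm.symm)) := by
  rw [Fin.comp_cons, Fin.comp_cons, append_cast_swap hkm hmk f g, ← Function.comp_assoc]
  change AlternatingMap.curryLeft o.volumeForm (b 0) ((⇑b ∘ Fin.append f g ∘ Fin.cast hkm.symm) ∘
      ⇑(finRotate N ^ k)) = _ * AlternatingMap.curryLeft o.volumeForm (b 0)
        (⇑b ∘ Fin.append f g ∘ Fin.cast hkm.symm)
  rw [AlternatingMap.map_perm, Units.smul_def, zsmul_eq_mul, sign_finRotate_pow hkm, Int.cast_pow,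
    Int.cast_neg, Int.cast_one]

end ConsBlock

end HodgeStarAux

/-! ### The main identity -/

section Main

open HodgeStarAux
open scoped RealInnerProductSpace

variable {V : Type*} [NormedAddCommGroup V] [InnerProductSpace ℝ V] [FiniteDimensional ℝ V]
  {k m N : ℕ} [Fact (finrank ℝ V = N + 1)] (o : Orientation ℝ V (Fin (N + 1)))

/-- Core of `hodgeStar_wedgeOne_hodgeStar`: the identity for the covector `⟪b 0, ·⟫` dual to the
first vector of an orthonormal basis `b`, checked on the increasing basis tuples of `b`.
[cite: Voisin2002, proof of Lemma 6.6] -/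
theorem hodgeStar_wedgeOne_hodgeStar_basis (b : OrthonormalBasis (Fin (N + 1)) ℝ V)
    (h₁ : (k + 1) + m = N + 1) (h₂ : (m + 1) + k = N + 1) (γ : V [⋀^Fin (k + 1)]→L[ℝ] ℝ) :
    hodgeStar o h₂ (wedgeOne (innerSL ℝ (b 0)) (hodgeStar o h₁ γ)) =
      ((-1 : ℝ) ^ (k * m)) • γ.curryLeft (b 0) := by
  have hkm : k + m = N := by omega
  have hmk : m + k = N := by omega
  have hb : ∀ i j, ⟪b i, b j⟫ = if i = j then (1 : ℝ) else 0 := orthonormal_iff_ite.1 b.orthonormal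
  refine ext_multiIndex b fun J ↦ ?_
  rw [ContinuousAlternatingMap.smul_apply, curryLeft_apply_apply,
    hodgeStar_apply_multiIndex_of_orthonormalBasis o b h₂]
  by_cases hJ : (0 : Fin (N + 1)) ∈ J
  · /- `0 ∈ J`: both sides vanish. -/
    obtain ⟨i, hi⟩ := exists_enum_eq_of_mem hJ
    have hR : γ (Matrix.vecCons (b 0) (b.multiIndex J)) = 0 :=
      γ.map_eq_zero_of_eq _ (i := 0) (j := i.succ) (by simp [hi]) (Fin.succ_ne_zero i).symm
    rw [hR, smul_zero]
    refine Finset.sum_eq_zero fun t _ ↦ ?_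
    by_cases ht : (0 : Fin (N + 1)) ∈ t
    · obtain ⟨j, hj⟩ := exists_enum_eq_of_mem ht
      rw [volumeForm_append_cast_eq_zero o b h₂ (i := j) (j := i) (hj.trans hi.symm), mul_zero]
    · have hW : wedgeOne (innerSL ℝ (b 0)) (hodgeStar o h₁ γ) (b.multiIndex t) = 0 := by
        rw [wedgeOne_apply]
        refine Finset.sum_eq_zero fun l _ ↦ ?_
        have hne : (0 : Fin (N + 1)) ≠ ofFinEmbEquiv.symm t l := fun h ↦ ht (h ▸ enum_mem t l)
        rw [OrthonormalBasis.multiIndex_apply, innerSL_apply_apply, hb, if_neg hne, zero_smul,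
          smul_zero]
      rw [hW, zero_mul]
  · /- `0 ∉ J`: the complement `T ∋ 0`, its tail `T'` and `S = J ∪ {0}`. -/
    have hcard : (m + 1) + k = Fintype.card (Fin (N + 1)) := by rw [Fintype.card_fin, h₂]
    set T : Set.powersetCard (Fin (N + 1)) (m + 1) := Set.powersetCard.compl hcard J with hT
    have hTJ : ∀ a, a ∈ T ↔ a ∉ J := fun a ↦ Set.powersetCard.mem_compl
    have h0T : (0 : Fin (N + 1)) ∈ T := (hTJ 0).2 hJ
    set T' : Set.powersetCard (Fin (N + 1)) m := ⟨_, card_erase_zero h0T⟩ with hT'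
    set S : Set.powersetCard (Fin (N + 1)) (k + 1) := ⟨_, card_insert_zero hJ⟩ with hS
    set f : Fin k → Fin (N + 1) := ⇑(ofFinEmbEquiv.symm J) with hf
    set g : Fin m → Fin (N + 1) := ⇑(ofFinEmbEquiv.symm T) ∘ Fin.succ with hg
    have henT' : ⇑(ofFinEmbEquiv.symm T') = g := enum_erase_zero h0T
    have henS : ⇑(ofFinEmbEquiv.symm S) = Fin.cons 0 f := enum_insert_zero hJ
    have henT : ⇑(ofFinEmbEquiv.symm T) = Fin.cons 0 g := by
      rw [hg, ← enum_zero_of_zero_mem h0T]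
      exact (Fin.cons_self_tail _).symm
    have hmemT' : ∀ a, a ∈ T' ↔ a ≠ 0 ∧ a ∉ J := fun a ↦ by
      rw [← mem_coe_iff, hT', Finset.mem_erase, mem_coe_iff, hTJ]
    have hmemS : ∀ a, a ∈ S ↔ a = 0 ∨ a ∈ J := fun a ↦ by
      rw [← mem_coe_iff, hS, Finset.mem_insert, mem_coe_iff]
    -- Step 1: the outer sum collapses to `t = T`.
    have h1 : ∀ t, t ≠ T → wedgeOne (innerSL ℝ (b 0)) (hodgeStar o h₁ γ) (b.multiIndex t) *
        o.volumeForm (b ∘ (Fin.append (ofFinEmbEquiv.symm t) (ofFinEmbEquiv.symm J) ∘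
          Fin.cast h₂.symm)) = 0 := fun t ht ↦ by
      obtain ⟨a, hat, haT⟩ := (exists_mem_notMem_iff_ne t T).1 ht
      obtain ⟨i, hi⟩ := exists_enum_eq_of_mem hat
      obtain ⟨j, hj⟩ := exists_enum_eq_of_mem (not_not.1 (mt (hTJ a).2 haT))
      rw [volumeForm_append_cast_eq_zero o b h₂ (i := i) (j := j) (hi.trans hj.symm), mul_zero]
    rw [Fintype.sum_eq_single T h1]
    -- Step 2: `(ξ ∧ ⋆γ)(b_T) = (⋆γ)(b_{T'})`.
    have h2 : wedgeOne (innerSL ℝ (b 0)) (hodgeStar o h₁ γ) (b.multiIndex T) =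
        hodgeStar o h₁ γ (b.multiIndex T') := by
      rw [wedgeOne_apply, Fin.sum_univ_succ, Finset.sum_eq_zero fun l _ ↦ ?_]
      · have e0 : b.multiIndex T 0 = b 0 := by
          rw [OrthonormalBasis.multiIndex_apply, enum_zero_of_zero_mem h0T]
        have etail : Fin.removeNth 0 (b.multiIndex T) = b.multiIndex T' := by
          funext j
          simp only [Fin.removeNth_zero, Fin.tail, OrthonormalBasis.multiIndex_apply, henT', hg,
            comp_apply]
        rw [e0, etail, innerSL_apply_apply, hb, if_pos rfl]
        simp
      · have hne : (0 : Fin (N + 1)) ≠ ofFinEmbEquiv.symm T l.succ := (enum_succ_ne_zero h0T l).symm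
        rw [OrthonormalBasis.multiIndex_apply, innerSL_apply_apply, hb, if_neg hne, zero_smul,
          smul_zero]
    -- Step 3: the inner sum collapses to `s = S`.
    have h3 : hodgeStar o h₁ γ (b.multiIndex T') = γ (b.multiIndex S) *
        o.volumeForm (b ∘ (Fin.append (ofFinEmbEquiv.symm S) (ofFinEmbEquiv.symm T') ∘
          Fin.cast h₁.symm)) := by
      rw [hodgeStar_apply_multiIndex_of_orthonormalBasis o b h₁]
      refine Fintype.sum_eq_single S fun s hs ↦ ?_
      obtain ⟨a, has, haS⟩ := (exists_mem_notMem_iff_ne s S).1 hs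
      obtain ⟨i, hi⟩ := exists_enum_eq_of_mem has
      have haT' : a ∈ T' := (hmemT' a).2 (not_or.1 (mt (hmemS a).2 haS))
      obtain ⟨j, hj⟩ := exists_enum_eq_of_mem haT'
      rw [volumeForm_append_cast_eq_zero o b h₁ (i := i) (j := j) (hi.trans hj.symm), mul_zero]
    -- Step 4: `γ(b_S) = γ(b 0, b_J)`.
    have h4 : γ (b.multiIndex S) = γ (Matrix.vecCons (b 0) (b.multiIndex J)) := by
      congr 1
      funext i
      refine Fin.cases ?_ (fun j ↦ ?_) i
      · rw [OrthonormalBasis.multiIndex_apply, henS]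
        simp
      · rw [OrthonormalBasis.multiIndex_apply, henS]
        simp [OrthonormalBasis.multiIndex_apply, hf]
    -- Step 5: the two volume factors.
    have hv1 : o.volumeForm (b ∘ (Fin.append (ofFinEmbEquiv.symm S) (ofFinEmbEquiv.symm T') ∘
        Fin.cast h₁.symm)) = o.volumeForm (b ∘ Fin.cons 0 (Fin.append f g ∘ Fin.cast hkm.symm)) := by
      rw [henS, henT', append_cons_comp_cast (0 : Fin (N + 1)) f g h₁ hkm]
    have hv2 : o.volumeForm (b ∘ (Fin.append (ofFinEmbEquiv.symm T) (ofFinEmbEquiv.symm J) ∘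
        Fin.cast h₂.symm)) =
          (-1) ^ (k * m) * o.volumeForm (b ∘ Fin.cons 0 (Fin.append f g ∘ Fin.cast hkm.symm)) := by
      rw [henT, ← hf, append_cons_comp_cast (0 : Fin (N + 1)) g f h₂ hmk,
        volumeForm_cons_block_swap o b hkm hmk]
    have hinj : Function.Bijective (Fin.cons (0 : Fin (N + 1)) (Fin.append f g ∘ Fin.cast hkm.symm)) := by
      refine Function.Injective.bijective_of_finite (Fin.cons_injective_iff.2 ⟨?_, ?_⟩)
      · rintro ⟨x, hx⟩
        obtain ⟨y, rfl⟩ : ∃ y, Fin.cast hkm y = x := ⟨Fin.cast hkm.symm x, by simp⟩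
        simp only [comp_apply, Fin.cast_cast, Fin.cast_eq_self] at hx
        cases y using Fin.addCases with
        | left i =>
          rw [Fin.append_left] at hx
          exact hJ (hx ▸ enum_mem J i)
        | right j =>
          rw [Fin.append_right] at hx
          exact enum_succ_ne_zero h0T j hx
      · refine append_cast_injective hkm (ofFinEmbEquiv.symm J).injective
          ((ofFinEmbEquiv.symm T).injective.comp (Fin.succ_injective _)) fun i j hij ↦ ?_
        have hiT : f i ∈ T := by
          rw [hij]
          exact enum_mem T j.succ
        exact (hTJ _).1 hiT (enum_mem J i)
    have hsq := volumeForm_comp_mul_self o b hinj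
    rw [h2, h3, h4, hv1, hv2]
    linear_combination ((-1 : ℝ) ^ (k * m) * γ (Matrix.vecCons (b 0) (b.multiIndex J))) * hsq

end Main

section General

open HodgeStarAux
open scoped RealInnerProductSpace

variable {V : Type*} [NormedAddCommGroup V] [InnerProductSpace ℝ V] [FiniteDimensional ℝ V]
  {k m n : ℕ} [Fact (finrank ℝ V = n)] (o : Orientation ℝ V (Fin n))

/-- **`⋆(ξ ∧ ⋆γ) = (-1)^{km} ι_{ξ♯} γ`.** On an oriented `n`-dimensional real inner product space,
for a covector `ξ`, a `(k+1)`-form `γ` and the Hodge stars `Λ^{k+1} → Λ^m → ` (via `ξ ∧ ·`)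
` Λ^{m+1} → Λ^k`: `⋆ (ξ ∧ ⋆γ) = (-1)^{km} • γ.curryLeft ξ♯` with `ξ♯ = (toDual ℝ V).symm ξ` the
Riesz dual vector. (For even `n` the sign is `+1` in all degrees.) This is the linear algebra behind
`d* = (-1)^{n(p+1)+1} ⋆d⋆ = -∑ᵢ ι_{eᵢ} ∇_{eᵢ}` and, on a Hermitian vector space, behind the
symbol computation `∂̄* = -⋆∂⋆ = -2∑ᵢ int(∂/∂z̄ᵢ) ∂/∂zᵢ` of Voisin (2002), proof of Lemma 6.6
(p. 140); Warner (1983), Ex. 2.13–2.14, 6.1–6.2. Proof: by linearity in `ξ` reduce to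
`ξ = ⟪e₀, ·⟫` for a unit vector, extend `e₀` to an orthonormal basis
(`Orthonormal.exists_orthonormalBasis_extension_of_card_eq`) and apply
`hodgeStar_wedgeOne_hodgeStar_basis`. [cite: Voisin2002, Lemma 6.6 (proof), p. 140] -/
theorem hodgeStar_wedgeOne_hodgeStar (h₁ : (k + 1) + m = n) (h₂ : (m + 1) + k = n) (ξ : V →L[ℝ] ℝ)
    (γ : V [⋀^Fin (k + 1)]→L[ℝ] ℝ) :
    hodgeStar o h₂ (wedgeOne ξ (hodgeStar o h₁ γ)) =
      ((-1 : ℝ) ^ (k * m)) • γ.curryLeft ((InnerProductSpace.toDual ℝ V).symm ξ) := by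
  obtain ⟨N, rfl⟩ : ∃ N, n = N + 1 := ⟨k + m, by omega⟩
  set u : V := (InnerProductSpace.toDual ℝ V).symm ξ with hu
  have hξ : ξ = InnerProductSpace.toDual ℝ V u := by simp [hu]
  by_cases hu0 : u = 0
  · rw [hu0, _root_.map_zero, smul_zero, hξ, hu0, _root_.map_zero]
    have : wedgeOne (0 : V →L[ℝ] ℝ) (hodgeStar o h₁ γ) = 0 := by
      rw [← zero_smul ℝ (0 : V →L[ℝ] ℝ), wedgeOne_smul_left, zero_smul]
    rw [this, _root_.map_zero]
  · -- the unit vector `e₀ = u / ‖u‖`, extended to an orthonormal basis `b` with `b 0 = e₀`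
    set e₀ : V := ‖u‖⁻¹ • u with he₀
    have hnorm : ‖e₀‖ = 1 := by
      rw [he₀, norm_smul, norm_inv, norm_norm, inv_mul_cancel₀ (norm_ne_zero_iff.2 hu0)]
    have hon : Orthonormal ℝ (({0} : Set (Fin (N + 1))).restrict fun _ : Fin (N + 1) ↦ e₀) :=
      ⟨fun _ ↦ hnorm, fun i j hij ↦ absurd (Subsingleton.elim i j) hij⟩
    obtain ⟨b, hb⟩ := hon.exists_orthonormalBasis_extension_of_card_eq
      (by rw [Fintype.card_fin]; exact Fact.out)
    have hb0 : b 0 = e₀ := hb 0 rfl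
    have hue : u = ‖u‖ • b 0 := by
      rw [hb0, he₀, smul_smul, mul_inv_cancel₀ (norm_ne_zero_iff.2 hu0), one_smul]
    have htd : InnerProductSpace.toDual ℝ V (b 0) = innerSL ℝ (b 0) :=
      ContinuousLinearMap.ext fun v ↦ by
        rw [InnerProductSpace.toDual_apply_apply, innerSL_apply_apply]
    have hξ' : ξ = ‖u‖ • innerSL ℝ (b 0) := by
      rw [hξ]
      conv_lhs => rw [hue, map_smul, htd]
    conv_rhs => rw [hue, map_smul]
    rw [hξ', wedgeOne_smul_left, map_smul, hodgeStar_wedgeOne_hodgeStar_basis o b h₁ h₂ γ,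
      smul_comm]

end General

end Literature.Geometry.Kaehler


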